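/-
Cell pub-hodgecm2 (COR-CM = stage 2 of the Hodge ladder), seat p2 (binder prover 2/8), gen 22
(prover-pub-hodgecm2-p2-g22-0), 2026-08-21.  Count-neutral own lane PERL-WEIL-LINE = work item W-a of
`hodge-director/B01-SIZE.md` §4 T2, realisation-free part.  This module SUPERSEDES the pending proposal p290091
(`CorCM/PerLWeilLineClassesRealisations.lean`, same theorems and names, whose `variable (hHD …)` section line routes
it to the review lane; it will bounce `name exists` once this file lands and is not re-filed).  Theorems only; `PerL`
is CONSUMED BY NAME (`Universe.PerL`, `CorCM/Geometry/Statements.lean`), never restated.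
T5: the only hypothesis binders of Literature/conjecture type are the four universe records (all tree theorems:
`exists_isReal_hodgeModel_holds`, `hodgePQ_independent_of_hodgeModel_holds`, `ballQuotientUniformisedDatum_holds`,
`cmAbelianVarietyRealised_holds`) and `hP : U.PerL`; joint inhabitation = PerL(U_rec), the cell's standing
hypothesis; no contradiction derived.  HONEST FRAMING: HC_CM is NOT proved.
-/
import Summits.HodgeConjecture.CorCM.SurfaceCriterionQuadruple
import Summits.HodgeConjecture.CorCM.Model.WeilLineClassesOfWeilLineAlg
import Summits.HodgeConjecture.CorCM.Model.ModelAxiomsHolds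
import Summits.HodgeConjecture.CorCM.Model.CMAbelianVarietyRealisedHolds
import Summits.HodgeConjecture.CorCM.Geometry.BallQuotientUniformisedHolds
import Literature.AlgebraicGeometry.HodgeTheory.ComplexConjugationHolds
import Literature.AlgebraicGeometry.HodgeTheory.HodgeFiltrationModelsReductionProofs
import Literature.AlgebraicGeometry.HodgeTheory.WeilLineClassesIsogenyTransport
import Literature.AlgebraicGeometry.ComplexMultiplication.CMTypeConjugateIsogeny
import HarnessLib

/-!
# What `PerL` certifies, realisation-free: for ANY realisations of the PerL corner types the `K`-Weil-line
# classes are algebraic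

`CorCM/PerLWeilLineClasses.lean` (p289327) reads the Hodge-theoretic content of `PerL` on the cell's CHOSEN
realisations `Model.cornerAV h₃ K Φ` (`cmRealisation … (cmCode K (Φ j))`); this file re-derives that arrow directly
from `CorCM/SurfaceCriterionQuadruple.lean` + `Model/WeilLineClassesOfWeilLineAlg.lean` (so that it does not wait for
that module's olean) and makes it realisation-free.  Since algebraicity of the `K`-Weil-line classes of a
family of CM-type realisations depends only on the types (`weilLineClasses_le_algebraicClasses_of_isCMTypeRealisation`,
`Literature/AlgebraicGeometry/HodgeTheory/WeilLineClassesIsogenyTransport.lean`: Shimura 1998 §6.1 Cor. gives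
slotwise equivariant isogenies, along which Weil-line algebraicity transports), the statement holds for EVERY
realisation family:

* **`Model.weilLineClasses_le_algebraicClasses_of_perL_of_isCMTypeRealisation`** — `U.PerL` (model universe
  `U = Model.universeOf hHD hI hU h₃`) ⟹ for every stage-1 configuration `(K, L, j, φ, ι₁, t)` and EVERY family
  `(A_i, act_i, θ_i)_{i<4}` of realisations of the corner types `(t⁰, t̄², t̄³, t¹)`:
  `weilLineClasses A act 4 ≤ algebraicClasses (⨁ A).X 2`;  `…_rec` on the model universe of record.
* `Model.weilLineClasses_le_algebraicClasses_of_periodNV_of_isCMTypeRealisation` (+ `_rec`) — the same from ONE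
  non-vanishing Picard-modular period `U.PeriodNV ι₁ V K Ψ σ`, for ANY `(K, Ψ, σ)` and any surface field `L`
  (the per-configuration arrow of the existence lane, realisation-free); chosen-realisation forms
  `…_of_periodNV (hHD hI hU h₃) (h)` / `…_of_perL …` are `Model.weilLineClasses_le_algebraicClasses_of_periodNV/_of_perL`
  in `CorCM/PerLWeilLineClasses.lean`.
* `isCMTypeRealisation_bar_comp_complexConj` — a realisation of `(K; Φ)` on `X` is a realisation of `(K; Φ̄)` on
  the SAME `X` with the action twisted by complex conjugation (Deligne 1982 §5 (b); the tree's
  `IsCMTypeRealisation.comp_complexConj`), so realisations `X₀, X₁, X₂, X₃` of the ORIGINAL PerL types `t⁰,…,t³`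
  give the corner family `(X₀, act₀), (X₂, act₂ ∘ c), (X₃, act₃ ∘ c), (X₁, act₁)`:
  **`Model.weilLineClasses_perLTypes_le_algebraicClasses_of_perL_rec`** — for ANY realisations `(X_i, act_i, θ_i)`
  of the four PerL types, `PerL(U_rec)` makes the `K`-Weil-line classes of that corner family algebraic on
  `X₀ ⊕ X₂ ⊕ X₃ ⊕ X₁` — the «face 4-set» classes `{(0,s), (2,s̄), (3,s̄), (1,s)}` of the Pohlmann census of the
  four threefolds (seat b25's W-b lane `Census/PairFlipSexticFourCore*` decides that these classes and the divisors
  generate the Hodge ring of every product of powers of `X₀,…,X₃`).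

References: Shimura 1998 §6.1 Cor. of Thm 2 + Remark; Deligne LNM 900 §5 (b); Milne 2020 §2; van Geemen 1994
3.6–3.7; `hodge-director/B01-SIZE.md` §4 T2.
-/

noncomputable section

open CategoryTheory CategoryTheory.Limits NumberField
open Literature.AlgebraicGeometry.Motives Literature.AlgebraicGeometry.HodgeTheory
open Literature.AlgebraicGeometry.ComplexMultiplication Literature.NumberTheory.Automorphic
open Literature.NumberTheory.Automorphic.PicardCM (BallQuotientUniformisedDatum CMAbelianVarietyRealised eigenline)
open Literature.NumberTheory.ComplexMultiplication.CMTypeOps (bar mem_bar_iff_conjugate_mem)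
open NumberField.ComplexEmbedding (conjugate)

namespace Summit.HodgeConjecture.CorCM.Model

/-! ## §0 Conjugate type on the same variety -/

/-- **A realisation of `(K; Φ)` on `X` is a realisation of `(K; Φ̄)` on the same `X`** with the `𝓞_K`-action and
the `H¹`-action twisted by the complex conjugation `c` of the CM field `K` (Deligne 1982 §5 (b): `(A_Φ, ι ∘ σ⁻¹)` is
of type `σΦ`; the tree's `IsCMTypeRealisation.comp_complexConj` at `Φ' = Φ̄`, `φ ∈ Φ̄ ↔ φ̄ ∈ Φ`).
[cite: Deligne1982HodgeCycles, §5 (b) (TeXed re-edition p. 38)] -/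
theorem isCMTypeRealisation_bar_comp_complexConj {K : Type} [Field K] [NumberField K] [IsCMField K]
    {Φ : CMType K} {X : AbelianVariety ℂ} {act : 𝓞 K →+* End X}
    {θ : K →+* Module.End ℂ (complexBetti X.X 1)} (h : IsCMTypeRealisation Φ X act θ) :
    IsCMTypeRealisation (bar Φ) X
      (act.comp (RingOfIntegers.mapRingHom (IsCMField.complexConj K).toRingEquiv.toRingHom))
      (θ.comp (IsCMField.complexConj K).toRingEquiv.toRingHom) :=
  h.comp_complexConj (mem_bar_iff_conjugate_mem Φ)

/-! ## §1 On any instance of the model universe -/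

section General


/-- **Period ⟹ algebraic `K`-Weil-line classes for ANY realisations of the corner types.**  A non-vanishing
Picard-modular period `U.PeriodNV ι₁ V K Ψ σ` on the model universe (ANY CM field `K`, quadruple `Ψ`, `σ`, surface
field `L`) makes the `K`-Weil-line classes of EVERY family `(A_i, act_i, θ_i)` realising the corner types
`(Ψ₀, Ψ̄₂, Ψ̄₃, Ψ₁)` algebraic on `⨁_i A_i` (the chosen realisations by `PerLWeilLineClasses`, any others by
isogeny transport, Shimura 1998 §6.1 Cor.). [cite: Shimura1998, §6.1 Corollary of Theorem 2 and Remark, printed p. 41] -/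
theorem weilLineClasses_le_algebraicClasses_of_periodNV_of_isCMTypeRealisation
    (hHD : exists_isReal_hodgeModel) (hI : hodgePQ_independent_of_hodgeModel)
    (hU : BallQuotientUniformisedDatum) (h₃ : CMAbelianVarietyRealised)
    {L : CMField} {ι₁ : L →+* ℂ}
    {V : HermSpace3 L ι₁} {K : CMField} {Ψ : Fin 4 → CMType K} {σ : K →+* ℂ}
    (h : (universeOf hHD hI hU h₃).PeriodNV ι₁ V K Ψ σ)
    {A : Fin 4 → AbelianVariety ℂ} {act : ∀ i, 𝓞 K →+* End (A i)}
    {θ : ∀ i, (K : Type) →+* Module.End ℂ (complexBetti (A i).X 1)}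
    (hA : ∀ i, IsCMTypeRealisation ((![Ψ 0, bar (Ψ 2), bar (Ψ 3), Ψ 1] : Fin 4 → CMType K) i) (A i) (act i)
      (θ i)) :
    weilLineClasses A act 4 ≤ algebraicClasses (⨁ A).X 2 :=
  weilLineClasses_le_algebraicClasses_of_isCMTypeRealisation (p := 2) hA
    (fun i => cornerAV_isCMTypeRealisation h₃ K ![Ψ 0, bar (Ψ 2), bar (Ψ 3), Ψ 1] i)
    (weilLineClasses_le_algebraicClasses_of_weilLine_le_alg hHD hI hU h₃ K _
      ((universeOf hHD hI hU h₃).weilLine_quad_le_alg_of_periodNV (modelAxioms_holds hHD hI hU h₃) h))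

/-- **`PerL` ⟹ algebraic `K`-Weil-line classes for ANY realisations of the PerL corner types.**  If `U.PerL`
holds on the model universe `U = Model.universeOf hHD hI hU h₃`, then for every sextic CM field `K`, normal closure
`j : K → L` of degree `24` or `48`, frame `φ`, `ι₁` over `φ 0`, PerL quadruple `t`, and EVERY family
`(A_i, act_i, θ_i)_{i<4}` of realisations of the corner types `(t⁰, t̄², t̄³, t¹)` (in particular for ANY four CM
abelian threefolds of these types, not only the cell's `cornerAV`): `weilLineClasses A act 4 ≤ algebraicClasses (⨁ A).X 2`.
NOT HC_CM. [cite: Shimura1998, §6.1 Corollary of Theorem 2 and Remark, printed p. 41] -/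
theorem weilLineClasses_le_algebraicClasses_of_perL_of_isCMTypeRealisation
    (hHD : exists_isReal_hodgeModel) (hI : hodgePQ_independent_of_hodgeModel)
    (hU : BallQuotientUniformisedDatum) (h₃ : CMAbelianVarietyRealised)
    (hP : (universeOf hHD hI hU h₃).PerL)
    (K L : CMField) (j : K →+* L) (hN : IsNormalClosure ℚ K L) (h6 : Module.finrank ℚ K = 6)
    (hL : Module.finrank ℚ L = 24 ∨ Module.finrank ℚ L = 48)
    (φ : Fin 3 → (K →+* ℂ)) (hφ : IsFrame φ) (ι₁ : L →+* ℂ) (hι : ι₁.comp j = φ 0)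
    (t : Fin 4 → CMType K) (ht : IsPerLTypes φ t)
    {A : Fin 4 → AbelianVariety ℂ} {act : ∀ i, 𝓞 K →+* End (A i)}
    {θ : ∀ i, (K : Type) →+* Module.End ℂ (complexBetti (A i).X 1)}
    (hA : ∀ i, IsCMTypeRealisation ((![t 0, bar (t 2), bar (t 3), t 1] : Fin 4 → CMType K) i) (A i) (act i)
      (θ i)) :
    weilLineClasses A act 4 ≤ algebraicClasses (⨁ A).X 2 :=
  weilLineClasses_le_algebraicClasses_of_isCMTypeRealisation (p := 2) hA
    (fun i => cornerAV_isCMTypeRealisation h₃ K ![t 0, bar (t 2), bar (t 3), t 1] i)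
    (weilLineClasses_le_algebraicClasses_of_weilLine_le_alg hHD hI hU h₃ K _
      ((universeOf hHD hI hU h₃).weilLine_le_alg_of_perL (modelAxioms_holds hHD hI hU h₃) hP K L j hN h6 hL φ hφ
        ι₁ hι t ht))

end General

/-! ## §2 On the model universe of record (hypothesis `PerL` only) -/

section Record

/-- **`PerL(U_rec)` ⟹ algebraic `K`-Weil-line classes for ANY realisations of the PerL corner types**, on the model
universe of record `U_rec = Model.picardCMUniverse exists_isReal_hodgeModel_holds hodgePQ_independent_of_hodgeModel_holds
BallQuotient.ballQuotientUniformised_holds cmAbelianVarietyRealised_holds`; single hypothesis `U_rec.PerL`.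
[cite: Shimura1998, §6.1 Corollary of Theorem 2 and Remark, printed p. 41] -/
theorem weilLineClasses_le_algebraicClasses_of_perL_rec_of_isCMTypeRealisation
    (hP : (picardCMUniverse exists_isReal_hodgeModel_holds hodgePQ_independent_of_hodgeModel_holds
      BallQuotient.ballQuotientUniformised_holds cmAbelianVarietyRealised_holds).PerL)
    (K L : CMField) (j : K →+* L) (hN : IsNormalClosure ℚ K L) (h6 : Module.finrank ℚ K = 6)
    (hL : Module.finrank ℚ L = 24 ∨ Module.finrank ℚ L = 48)
    (φ : Fin 3 → (K →+* ℂ)) (hφ : IsFrame φ) (ι₁ : L →+* ℂ) (hι : ι₁.comp j = φ 0)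
    (t : Fin 4 → CMType K) (ht : IsPerLTypes φ t)
    {A : Fin 4 → AbelianVariety ℂ} {act : ∀ i, 𝓞 K →+* End (A i)}
    {θ : ∀ i, (K : Type) →+* Module.End ℂ (complexBetti (A i).X 1)}
    (hA : ∀ i, IsCMTypeRealisation ((![t 0, bar (t 2), bar (t 3), t 1] : Fin 4 → CMType K) i) (A i) (act i)
      (θ i)) :
    weilLineClasses A act 4 ≤ algebraicClasses (⨁ A).X 2 :=
  weilLineClasses_le_algebraicClasses_of_perL_of_isCMTypeRealisation exists_isReal_hodgeModel_holds
    hodgePQ_independent_of_hodgeModel_holds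
    (PicardCM.ballQuotientUniformisedDatum_of BallQuotient.ballQuotientUniformised_holds) cmAbelianVarietyRealised_holds
    hP K L j hN h6 hL φ hφ ι₁ hι t ht hA

/-- On the model universe of record: ONE non-vanishing Picard-modular period for `(K, Ψ, σ)` makes the
`K`-Weil-line classes of EVERY realisation family of the corner types `(Ψ₀, Ψ̄₂, Ψ̄₃, Ψ₁)` algebraic.
[cite: Shimura1998, §6.1 Corollary of Theorem 2 and Remark, printed p. 41] -/
theorem weilLineClasses_le_algebraicClasses_of_periodNV_rec_of_isCMTypeRealisation {L : CMField}
    {ι₁ : L →+* ℂ} {V : HermSpace3 L ι₁} {K : CMField} {Ψ : Fin 4 → CMType K} {σ : K →+* ℂ}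
    (h : (picardCMUniverse exists_isReal_hodgeModel_holds hodgePQ_independent_of_hodgeModel_holds
      BallQuotient.ballQuotientUniformised_holds cmAbelianVarietyRealised_holds).PeriodNV ι₁ V K Ψ σ)
    {A : Fin 4 → AbelianVariety ℂ} {act : ∀ i, 𝓞 K →+* End (A i)}
    {θ : ∀ i, (K : Type) →+* Module.End ℂ (complexBetti (A i).X 1)}
    (hA : ∀ i, IsCMTypeRealisation ((![Ψ 0, bar (Ψ 2), bar (Ψ 3), Ψ 1] : Fin 4 → CMType K) i) (A i) (act i)
      (θ i)) :
    weilLineClasses A act 4 ≤ algebraicClasses (⨁ A).X 2 :=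
  weilLineClasses_le_algebraicClasses_of_periodNV_of_isCMTypeRealisation exists_isReal_hodgeModel_holds
    hodgePQ_independent_of_hodgeModel_holds
    (PicardCM.ballQuotientUniformisedDatum_of BallQuotient.ballQuotientUniformised_holds) cmAbelianVarietyRealised_holds
    h hA

/-- **`PerL(U_rec)` read on ANY realisations of the ORIGINAL four PerL types.**  Let `(X_i, act_i, θ_i)` realise
`(K; tⁱ)` for `i < 4` (e.g. four simple CM abelian threefolds of the four types — any choice in their isogeny
classes).  With the complex conjugation `c` of `K`, the family `(X₀, act₀), (X₂, act₂ ∘ 𝓞(c)), (X₃, act₃ ∘ 𝓞(c)),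
(X₁, act₁)` realises the corner types `(t⁰, t̄², t̄³, t¹)` (`isCMTypeRealisation_bar_comp_complexConj`), so
`PerL(U_rec)` makes ITS `K`-Weil-line classes — on the abelian 12-fold `X₀ ⊕ X₂ ⊕ X₃ ⊕ X₁`, the classes spanned by
the weight monomials `{(0,s), (2,s̄), (3,s̄), (1,s)}`, `s : K → ℂ` — algebraic.  NOT HC_CM.
[cite: Shimura1998, §6.1 Corollary of Theorem 2 and Remark, printed p. 41] [cite: Deligne1982HodgeCycles, §5 (b)] -/
theorem weilLineClasses_perLTypes_le_algebraicClasses_of_perL_rec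
    (hP : (picardCMUniverse exists_isReal_hodgeModel_holds hodgePQ_independent_of_hodgeModel_holds
      BallQuotient.ballQuotientUniformised_holds cmAbelianVarietyRealised_holds).PerL)
    (K L : CMField) (j : K →+* L) (hN : IsNormalClosure ℚ K L) (h6 : Module.finrank ℚ K = 6)
    (hL : Module.finrank ℚ L = 24 ∨ Module.finrank ℚ L = 48)
    (φ : Fin 3 → (K →+* ℂ)) (hφ : IsFrame φ) (ι₁ : L →+* ℂ) (hι : ι₁.comp j = φ 0)
    (t : Fin 4 → CMType K) (ht : IsPerLTypes φ t)
    (X : Fin 4 → AbelianVariety ℂ) (act : ∀ i, 𝓞 K →+* End (X i))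
    (θ : ∀ i, (K : Type) →+* Module.End ℂ (complexBetti (X i).X 1))
    (hX : ∀ i, IsCMTypeRealisation (t i) (X i) (act i) (θ i)) :
    weilLineClasses (fun i : Fin 4 => X ((![0, 2, 3, 1] : Fin 4 → Fin 4) i))
        (fun i : Fin 4 => match i with
          | 0 => act 0
          | 1 => (act 2).comp (RingOfIntegers.mapRingHom (IsCMField.complexConj K).toRingEquiv.toRingHom)
          | 2 => (act 3).comp (RingOfIntegers.mapRingHom (IsCMField.complexConj K).toRingEquiv.toRingHom)
          | 3 => act 1) 4 ≤
      algebraicClasses (⨁ fun i : Fin 4 => X ((![0, 2, 3, 1] : Fin 4 → Fin 4) i)).X 2 :=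
  weilLineClasses_le_algebraicClasses_of_perL_rec_of_isCMTypeRealisation hP K L j hN h6 hL φ hφ ι₁ hι t ht
    (θ := fun i : Fin 4 => match i with
      | 0 => θ 0
      | 1 => (θ 2).comp (IsCMField.complexConj K).toRingEquiv.toRingHom
      | 2 => (θ 3).comp (IsCMField.complexConj K).toRingEquiv.toRingHom
      | 3 => θ 1)
    (fun i => match i with
      | 0 => hX 0
      | 1 => isCMTypeRealisation_bar_comp_complexConj (hX 2)
      | 2 => isCMTypeRealisation_bar_comp_complexConj (hX 3)
      | 3 => hX 1)

end Record

end Summit.HodgeConjecture.CorCM.Model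

end
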